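import Summits.CriticalPhenomena.PercolationContinuityZ3.Theorems.PercNearOneGluingNoHeavyLowerTailQuantitativeAntitheticMonotone
import HarnessLib

/-!
# The one-pair identity of the antithetic size-law functional (PROOFS §P69 head; BENCH rows M2-R99 / M2-R101)

Support file (`--supports stmt-CriticalPhenomena-4575`), prover seat `prim-rate-mine-2` (lane prim-rate, constants-miner (c);
`run/shared/lean/prim/prim-rate/prim-rate-mine-2/PROOFS.md` §P69).  No definitions, no named facts, no sorries; standard axioms.

SETTING (cube form, as in `…QuantitativeAntitheticMonotone`).  `s : Finset α` is the red pair set of a 2-colouring of `H = G − e`, `sᶜ` the blue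
one.  The three terminal readers of the functional `Ψ_C = (T + T′ + C)(F − F′)(G − G′)` of PROOFS §P68/§P69 come in two versions each:
index `0` = read in `G − e` (pair `e` absent), index `1` = read in `G / e` (pair `e` present / glued); as real numbers `t₀ s, t₁ s, f₀ s, …`
(for the graph functional these are 0/1 and monotone, but the identity below is purely algebraic and needs nothing).  With
`Ψ(i,j)(s) := (tᵢ s + tⱼ sᶜ + C)(fᵢ s − fⱼ sᶜ)(gᵢ s − gⱼ sᶜ)` one has (PROOFS §P69): `Φ_C(G) = Σ_s [Ψ(1,0) + Ψ(0,1)]`, `Φ_C(G−e) = Σ_s Ψ(0,0)`,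
`Φ_C(G/e) = Σ_s Ψ(1,1)`, hence the deletion increment `T_e := Φ_C(G) − Φ_C(G−e) = Φ_C(G/e) − Σ_s δ(s)` with the MIXED SECOND DIFFERENCE
`δ = Ψ(1,1) − Ψ(1,0) − Ψ(0,1) + Ψ(0,0)`, which for the trilinear form `τ·y·z` is explicit in the increments `dT = t₁−t₀`, `dF`, `dG` (red) and
`dT′, dF′, dG′` (blue, read at `sᶜ`):
`δ = −τ(dF·dG′ + dG·dF′) + z(dF·dT′ − dT·dF′) + y(dG·dT′ − dT·dG′) + [dT′·dF·dG − dT′(dF·dG′ + dG·dF′) + dT(dF′·dG′ − dF·dG′ − dG·dF′)]`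
(`τ = t₀ s + t₀ sᶜ + C`, `y = f₀ s − f₀ sᶜ`, `z = g₀ s − g₀ sᶜ`).

* `CSH.antithetic_trilinear_pair_identity` — **`Σ_s [Ψ(1,0) + Ψ(0,1) − Ψ(0,0)] = Σ_s Ψ(1,1) − Σ_s δ`** with `δ` in the explicit form above
  (T117 of the seat's G26-THEOREMS; the case `t ≡ 0, C = 1` is `CSH.antithetic_pairSum_identity`, whose `δ = −(dF·dG′ + dF′·dG)` gives the
  monotonicity theorem (DS) `CSH.antithetic_covSum_mono`).  The conjecture (D_a) of BENCH row M2-R101 is `Σ_s δ ≤ Φ_C(G/e)` for pairs `e` at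
  the weight vertex; by `CSH.antithetic_nonneg_of_deletion_mono` it implies the antithetic size law (A½).
[cite: Harris1960, Lemma 4.1 (p. 16)]
-/

namespace Summit.CriticalPhenomena.PercolationContinuityZ3.Theorems.CSH

open Finset

variable {α : Type*} [Fintype α] [DecidableEq α]

/-- **The one-pair identity with the explicit mixed second difference** (PROOFS §P69, T117): for arbitrary real readers
`t₀ t₁ f₀ f₁ g₀ g₁ : Finset α → ℝ` and constant `C`, writing `Ψ(i,j)(s) = (tᵢ s + tⱼ sᶜ + C)(fᵢ s − fⱼ sᶜ)(gᵢ s − gⱼ sᶜ)`: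
`Σ_s [Ψ(1,0)(s) + Ψ(0,1)(s) − Ψ(0,0)(s)] = Σ_s Ψ(1,1)(s) − Σ_s δ(s)`, where `δ` is the explicit trilinear mixed difference in the increments
`dT = t₁ s − t₀ s`, `dF`, `dG`, `dT′ = t₁ sᶜ − t₀ sᶜ`, `dF′`, `dG′` (see the module docstring).  Graph reading: `T_e = Φ_C(G) − Φ_C(G − e) =
Φ_C(G / e) − Σ δ`. [cite: Harris1960, Lemma 4.1 (p. 16)] -/
theorem antithetic_trilinear_pair_identity (t₀ t₁ f₀ f₁ g₀ g₁ : Finset α → ℝ) (C : ℝ) :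
    (∑ s : Finset α,
        ((t₁ s + t₀ sᶜ + C) * (f₁ s - f₀ sᶜ) * (g₁ s - g₀ sᶜ) +
          (t₀ s + t₁ sᶜ + C) * (f₀ s - f₁ sᶜ) * (g₀ s - g₁ sᶜ) -
          (t₀ s + t₀ sᶜ + C) * (f₀ s - f₀ sᶜ) * (g₀ s - g₀ sᶜ)))
      = (∑ s : Finset α, (t₁ s + t₁ sᶜ + C) * (f₁ s - f₁ sᶜ) * (g₁ s - g₁ sᶜ))
        - ∑ s : Finset α,
          ( -(t₀ s + t₀ sᶜ + C) * ((f₁ s - f₀ s) * (g₁ sᶜ - g₀ sᶜ) + (g₁ s - g₀ s) * (f₁ sᶜ - f₀ sᶜ))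
            + (g₀ s - g₀ sᶜ) * ((f₁ s - f₀ s) * (t₁ sᶜ - t₀ sᶜ) - (t₁ s - t₀ s) * (f₁ sᶜ - f₀ sᶜ))
            + (f₀ s - f₀ sᶜ) * ((g₁ s - g₀ s) * (t₁ sᶜ - t₀ sᶜ) - (t₁ s - t₀ s) * (g₁ sᶜ - g₀ sᶜ))
            + ((t₁ sᶜ - t₀ sᶜ) * (f₁ s - f₀ s) * (g₁ s - g₀ s)
                - (t₁ sᶜ - t₀ sᶜ) * ((f₁ s - f₀ s) * (g₁ sᶜ - g₀ sᶜ) + (g₁ s - g₀ s) * (f₁ sᶜ - f₀ sᶜ))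
                + (t₁ s - t₀ s) * ((f₁ sᶜ - f₀ sᶜ) * (g₁ sᶜ - g₀ sᶜ) - (f₁ s - f₀ s) * (g₁ sᶜ - g₀ sᶜ)
                    - (g₁ s - g₀ s) * (f₁ sᶜ - f₀ sᶜ)))) := by
  rw [← Finset.sum_sub_distrib]
  refine Finset.sum_congr rfl fun s _ => ?_
  ring

/-- **Corollary (the C-slope)**: specialising the identity to `t ≡ 0` recovers the exact one-pair identity of the antithetic covariance sum —
here in the convenient «increment» form `Σ[D(1,0)+D(0,1)−D(0,0)] = Σ D(1,1) + Σ (dF·dG′ + dG·dF′)` for arbitrary real readers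
(`CSH.antithetic_pairSum_identity` is the 0/1-indicator instance). [cite: Harris1960, Lemma 4.1 (p. 16)] -/
theorem antithetic_bilinear_pair_identity (f₀ f₁ g₀ g₁ : Finset α → ℝ) :
    (∑ s : Finset α,
        ((f₁ s - f₀ sᶜ) * (g₁ s - g₀ sᶜ) + (f₀ s - f₁ sᶜ) * (g₀ s - g₁ sᶜ) - (f₀ s - f₀ sᶜ) * (g₀ s - g₀ sᶜ)))
      = (∑ s : Finset α, (f₁ s - f₁ sᶜ) * (g₁ s - g₁ sᶜ))
        + ∑ s : Finset α, ((f₁ s - f₀ s) * (g₁ sᶜ - g₀ sᶜ) + (g₁ s - g₀ s) * (f₁ sᶜ - f₀ sᶜ)) := by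
  rw [← Finset.sum_add_distrib]
  refine Finset.sum_congr rfl fun s _ => ?_
  ring

end Summit.CriticalPhenomena.PercolationContinuityZ3.Theorems.CSH
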